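/-
Copyright: lit-balaban cell, Phase-2 proof seat p24 (gen 25).  Released under Apache 2.0 license as described in the
file LICENSE.
-/
import Literature.MathematicalPhysics.QuantumFieldTheory.Balaban1983to89.B3Ineq210ZeroLattice

/-!
# `Balaban1983to89.B3Ineq210ZeroLatticeRow` — [Balaban1983Higgs3] (2.10) p. 426 for the pieces `G^η_{(j)}(0)` of the
# infinite-volume zero-field propagator `G_k(0)` on `ηℤ^{d+1}`, SUMMED OVER A ROW: the uniform `ℓ^∞ → ℓ^∞` bound
# `Σ_{x′}|G^η_{(j)}(0)(x,x′)| ≤ O(1)(L^jη)²`, every dimension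

statement-level skeleton of published theorems with citation tags; proofs where landed; nothing here is a claim about
the Yang–Mills mass gap

CITATION HEADER.  T. Bałaban, *(Higgs)₂,₃ quantum fields in a finite volume. III. Renormalization*, Commun. Math. Phys.
**88** (1983) 411–445 [Balaban1983Higgs3] (cell paper B3; held text `paper:balaban1983-higgs-2-3-quantum-fields-finite-volume`,
journal page = PDF page + 410): p. 424 [PDF 14] (2.6), p. 426 [PDF 16] (2.10), p. 433 [PDF 23] («we substitute G_k(□,0) =
G_k(0) + δG_k(□,ηZ^d,0)»), p. 437 [PDF 27] («Using the inequalities … we can estimate (3.16) by a constant»).  Unit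
`lit-balaban-p24` gen 25; HOME `run/shared/lean/pub/lit-balaban/`; SKELETON row **B3.Eq2.10** (owner r15; head `proved`) —
an optional located member (cells only), companion of `B4Thm110ZeroLattice` (the same row-summed form for `G_k(0)` itself).

WHAT IS PRINTED.  p. 426, (2.10): «For the propagators G^η_{(j)} we apply the inequality |G^η_{(j)}(Ω, B̃; x, x′)| ≦
O(1)(L^jη)^{−d+2}e^{−δ₁(L^jη)^{−1}|x−x′|}, (2.10) and if the propagator is differentiated, then for each differentiation,
there is an additional factor (L^jη)^{−1} on the right side. … These inequalities will be used in the next chapter.»  The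
tree has (2.10) for the lattice pieces `G^η_{(j)}(0)` of p. 433's `G_k(0)` pointwise, in every dimension:
`B3Ineq210ZeroLattice.abs_pieceLat_le` (`|pieceLat ℓ k j a m² x x′| ≤ C·L^{−j(d+1)}(L^jη)²e^{−δ₁|x−x′|_∞/L^j}`, matrix units).

WHAT THIS MODULE PROVES (kernel-checked; theorems only; 0 `def`; 0 `sorry`; axioms standard).  The ROW-SUMMED consequence of
(2.10) that the §3 estimates use when a vertex function is bounded («we can estimate (3.16) by a constant», p. 437): summing the
printed profile over `x′ ∈ ηℤ^{d+1}` costs the volume factor `(L^j)^{d+1}` of the decay length, which cancels the prefactor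
`L^{−j(d+1)}` exactly —
* `pieceLat_rowSum_le`: there are `C′ > 0` (on `d`, `L`, the window) such that for every `k ≥ 1`, `j < k`, window point, row `x`
  and finite `F`: `Σ_{x′∈F}|G^η_{(j)}(0)(x,x′)| ≤ C′·(L^jη)²` (`(L^jη)² = (sc ℓ k j)^{−2}`, `sc = L^{k−j}`), via the uniform lattice
  sum `B4Sect5Proof.latticeSum_le` and the elementary bound `latticeConst (d+1) (δ₁/b) ≤ (2b(1 + (d+1)/δ₁))^{d+1}` (`b = L^j ≥ 1`;
  `(1 − e^{−t})^{−1} ≤ 1 + t^{−1}`);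
* `pieceLat_row_summable`: the full row series converges, `Σ_{x′}|G^η_{(j)}(0)(x,x′)| ≤ C′(L^jη)²` (and the column series
  converges too, `pieceLat_comm`);
* `pieceLat_apply_le`: for bounded `f` (`‖f‖ ≤ F_∞`) the series `Σ_{x′}G^η_{(j)}(0)(x,x′)f(x′)` converges absolutely and
  `|(G^η_{(j)}(0)f)(x)| ≤ C′(L^jη)²F_∞` — `‖G^η_{(j)}(0)‖_{ℓ^∞→ℓ^∞} ≤ O(1)(L^jη)²`, uniformly in `k`, `j < k` and the window;
* `pieceLatDiff_rowSum_le`: the derivative clause summed over a row, `Σ_{x′} n|G^η_{(j)}(0)(x+e_μ,x′) − G^η_{(j)}(0)(x,x′)| ≤ C″(L^jη)`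
  («for each differentiation, there is an additional factor (L^jη)^{−1}»; `abs_pieceLatDiff_le` summed the same way).

DICTIONARY / HONEST SCOPE.  (i) Zero field, `Ω = ηℤ^{d+1}`, matrix units of the lineage (physical kernel `= η^{−(d+1)}·pieceLat`,
so the physical row sum `Σ_{x′}η^{d+1}|G^η_{(j)}(0;x,x′)|` equals the matrix row sum bounded here); sup-norm distances.
(ii) The row-summed form is OUR consequence of the printed pointwise law (2.10) (a one-line computation the print does not
display); constants existential.  (iii) The derivative clause is given in the row-summed form only for the row-variable difference (`abs_pieceLatDiff_le`); no Hölder pieces.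
(iv) Value = the `ℓ^∞` operator size of the (2.6)-pieces of `G_k(0)` in every dimension (the `d + 1 = 3` profile sums of the
§3 files `B3Eq316ResolventZeroLattice.summable_profile_row` are dimension-specific); cells only; NOT summit progress.
-/

namespace Literature.MathematicalPhysics.QuantumFieldTheory.Balaban1983to89.B3Ineq210ZeroLatticeRow

open Finset Filter Topology
open Literature.MathematicalPhysics.QuantumFieldTheory.Balaban1983to89.B4ContourShift (supNorm supNorm_nonneg
  abs_le_supNorm)
open Literature.MathematicalPhysics.QuantumFieldTheory.Balaban1983to89.B4TwoRegion120 (supNorm_sub_comm)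
open Literature.MathematicalPhysics.QuantumFieldTheory.Balaban1983to89.B4Thm110ZeroBox (bj sc bj_pos bj_cast sc_pos)
open Literature.MathematicalPhysics.QuantumFieldTheory.Balaban1983to89.B4Sect5Proof (latticeConst latticeConst_nonneg
  latticeSum_le)
open Literature.MathematicalPhysics.QuantumFieldTheory.Balaban1983to89.B3Ineq210ZeroLattice (pieceLat pieceLat_comm
  abs_pieceLat_le abs_pieceLatDiff_le)

noncomputable section

variable {d : ℕ}

/-! ## §0 Kernel helpers: the lattice sum at decay length `b` -/

/-- kernel: `(1 − e^{−t})^{−1} ≤ 1 + t^{−1}` for `t > 0` (from `1 + t ≤ e^t`). [folklore] -/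
private theorem inv_one_sub_exp_neg_le {t : ℝ} (ht : 0 < t) : (1 - Real.exp (-t))⁻¹ ≤ 1 + t⁻¹ := by
  have h1 : Real.exp (-t) ≤ (1 + t)⁻¹ := by
    rw [Real.exp_neg]
    exact inv_anti₀ (by linarith) (by linarith [Real.add_one_le_exp t])
  have h2 : t / (1 + t) ≤ 1 - Real.exp (-t) := by
    have : t / (1 + t) = 1 - (1 + t)⁻¹ := by field_simp; ring
    rw [this]; linarith
  have h3 : 0 < t / (1 + t) := div_pos ht (by linarith)
  calc (1 - Real.exp (-t))⁻¹ ≤ (t / (1 + t))⁻¹ := inv_anti₀ h3 h2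
    _ = 1 + t⁻¹ := by field_simp; ring

/-- kernel: the sup-distance of `ℤ^{d+1}` is dominated by the lineage's `supNorm` of the difference. [folklore] -/
private theorem dist_le_supNorm (x y : Fin (d + 1) → ℤ) : dist x y ≤ supNorm (x - y) := by
  rw [dist_pi_le_iff (supNorm_nonneg _)]
  intro i
  rw [Int.dist_eq]
  have := abs_le_supNorm (x - y) i
  rw [Pi.sub_apply] at this
  exact_mod_cast this

/-- kernel: **THE LATTICE SUM AT DECAY LENGTH `b ≥ 1`** — `Σ_{y∈F} e^{−δ|x−y|_∞/b} ≤ (2b(1 + (d+1)/δ))^{d+1}` for every finite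
`F ⊂ ℤ^{d+1}`: the uniform bound `B4Sect5Proof.latticeSum_le` at rate `δ/b`, with `latticeConst (d+1) (δ/b) ≤ (2b(1+(d+1)/δ))^{d+1}`.
[folklore] -/
private theorem sum_exp_neg_div_le {δ b : ℝ} (hδ : 0 < δ) (hb : 1 ≤ b) (x : Fin (d + 1) → ℤ)
    (F : Finset (Fin (d + 1) → ℤ)) :
    ∑ y ∈ F, Real.exp (-(δ * supNorm (x - y) / b)) ≤ (2 * b * (1 + ((d : ℝ) + 1) / δ)) ^ (d + 1) := by
  have hb0 : 0 < b := by linarith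
  have hrate : 0 < δ / b := div_pos hδ hb0
  have h1 : ∑ y ∈ F, Real.exp (-(δ * supNorm (x - y) / b)) ≤ ∑ y ∈ F, Real.exp (-(δ / b * dist x y)) := by
    refine Finset.sum_le_sum fun y _ => Real.exp_le_exp.2 ?_
    have := mul_le_mul_of_nonneg_left (dist_le_supNorm x y) hrate.le
    have heq : δ / b * supNorm (x - y) = δ * supNorm (x - y) / b := by ring
    linarith
  refine h1.trans ((latticeSum_le (d + 1) hrate F x).trans ?_)
  -- `latticeConst (d+1) (δ/b) = (2(1 − e^{−(δ/b)/(d+1)})⁻¹)^{d+1} ≤ (2b(1 + (d+1)/δ))^{d+1}`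
  unfold latticeConst
  have ht : 0 < δ / b / ((d + 1 : ℕ) : ℝ) := div_pos hrate (by positivity)
  have hinv := inv_one_sub_exp_neg_le ht
  have hone : 0 ≤ 1 - Real.exp (-(δ / b / ((d + 1 : ℕ) : ℝ))) := by
    rw [sub_nonneg]; exact Real.exp_le_one_iff.2 (by linarith)
  have hstep : (1 - Real.exp (-(δ / b / ((d + 1 : ℕ) : ℝ))))⁻¹ ≤ b * (1 + ((d : ℝ) + 1) / δ) := by
    refine hinv.trans ?_
    have : (δ / b / ((d + 1 : ℕ) : ℝ))⁻¹ = b * (((d : ℝ) + 1) / δ) := by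
      push_cast
      field_simp
    rw [this]
    nlinarith [div_nonneg (by positivity : (0 : ℝ) ≤ (d : ℝ) + 1) hδ.le]
  have h2 : 2 * (1 - Real.exp (-(δ / b / ((d + 1 : ℕ) : ℝ))))⁻¹ ≤ 2 * b * (1 + ((d : ℝ) + 1) / δ) := by
    nlinarith
  exact pow_le_pow_left₀ (mul_nonneg (by norm_num) (inv_nonneg.2 hone)) h2 (d + 1)

/-! ## §1 (2.10) summed over a row: `‖G^η_{(j)}(0)‖_{∞→∞} ≤ O(1)(L^jη)²` -/

/-- **(2.10) FOR THE LATTICE PIECES, SUMMED OVER A ROW** (finite partial sums): there is `C′ > 0` (depending on `d`, `L = ℓ + 1`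
and the window only) such that for every `k ≥ 1`, `j < k`, `a ∈ [a₋,a₊]`, `m² ∈ [0,m²₊]`, every row `x` and finite `F ⊂ ℤ^{d+1}`:
`Σ_{x′∈F}|G^η_{(j)}(0)(x,x′)| ≤ C′·(L^jη)²` (`(L^jη)² = (sc ℓ k j)^{−2}` in the lineage's names) — the printed profile
`O(1)(L^jη)^{−d+2}e^{−δ₁|x−x′|/(L^jη)}` (matrix units: `B3Ineq210ZeroLattice.abs_pieceLat_le`) summed with the uniform lattice sum at
decay length `L^j`. [cite: Balaban1983Higgs3, (2.10) p.426; dictionary (zero field, Ω = ηℤ^{d+1}, row-summed form)] -/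
theorem pieceLat_rowSum_le (d ℓ : ℕ) (hℓ : 1 ≤ ℓ) (amin aplus m2plus : ℝ) (ha : 0 < amin) :
    ∃ C' : ℝ, 0 < C' ∧ ∀ (k : ℕ), 1 ≤ k → ∀ (j : ℕ), j < k → ∀ (a m2 : ℝ), amin ≤ a → a ≤ aplus → 0 ≤ m2 →
      m2 ≤ m2plus → ∀ (x : Fin (d + 1) → ℤ) (F : Finset (Fin (d + 1) → ℤ)),
        ∑ x' ∈ F, |pieceLat ℓ k j a m2 x x'| ≤ C' * (sc ℓ k j ^ 2)⁻¹ := by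
  obtain ⟨δ₁, C, hδ₁, hC, h⟩ := abs_pieceLat_le d ℓ hℓ amin aplus m2plus ha
  set K : ℝ := (2 * (1 + ((d : ℝ) + 1) / δ₁)) ^ (d + 1) with hK
  have hK0 : 0 < K := by positivity
  refine ⟨C * K, mul_pos hC hK0, ?_⟩
  intro k hk j hjk a m2 h1 h2 h3 h4 x F
  have hb1 : (1 : ℝ) ≤ ((bj ℓ j : ℕ) : ℝ) := by exact_mod_cast bj_pos ℓ j
  have hb0 : (0 : ℝ) < ((bj ℓ j : ℕ) : ℝ) := by linarith
  have hs := sc_pos ℓ k j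
  -- pointwise (2.10), then the lattice sum at decay length `b = L^j`
  have hpt : ∀ x', |pieceLat ℓ k j a m2 x x'| ≤ C * (((((bj ℓ j : ℕ) : ℝ)) ^ (d + 1))⁻¹ * (sc ℓ k j ^ 2)⁻¹)
      * Real.exp (-(δ₁ * supNorm (x - x') / ((bj ℓ j : ℕ) : ℝ))) :=
    fun x' => h k hk j hjk a m2 h1 h2 h3 h4 x x'
  have hsum := sum_exp_neg_div_le (d := d) hδ₁ hb1 x F
  calc ∑ x' ∈ F, |pieceLat ℓ k j a m2 x x'|
      ≤ ∑ x' ∈ F, C * (((((bj ℓ j : ℕ) : ℝ)) ^ (d + 1))⁻¹ * (sc ℓ k j ^ 2)⁻¹)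
          * Real.exp (-(δ₁ * supNorm (x - x') / ((bj ℓ j : ℕ) : ℝ))) := Finset.sum_le_sum fun x' _ => hpt x'
    _ = C * (((((bj ℓ j : ℕ) : ℝ)) ^ (d + 1))⁻¹ * (sc ℓ k j ^ 2)⁻¹)
          * ∑ x' ∈ F, Real.exp (-(δ₁ * supNorm (x - x') / ((bj ℓ j : ℕ) : ℝ))) := by rw [Finset.mul_sum]
    _ ≤ C * (((((bj ℓ j : ℕ) : ℝ)) ^ (d + 1))⁻¹ * (sc ℓ k j ^ 2)⁻¹)
          * (2 * ((bj ℓ j : ℕ) : ℝ) * (1 + ((d : ℝ) + 1) / δ₁)) ^ (d + 1) :=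
        mul_le_mul_of_nonneg_left hsum (by positivity)
    _ = C * K * (sc ℓ k j ^ 2)⁻¹ := by
        rw [hK, show (2 * ((bj ℓ j : ℕ) : ℝ) * (1 + ((d : ℝ) + 1) / δ₁))
          = ((bj ℓ j : ℕ) : ℝ) * (2 * (1 + ((d : ℝ) + 1) / δ₁)) by ring, mul_pow]
        field_simp

/-- **(2.10) FOR THE DIFFERENTIATED LATTICE PIECES, SUMMED OVER A ROW** («if the propagator is differentiated, then for each
differentiation, there is an additional factor (L^jη)^{−1}»): there is `C″ > 0` (on `d`, `L`, the window) such that for every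
`k ≥ 1`, `j < k`, window point, axis `μ`, row `x` and finite `F`:
`Σ_{x′∈F} n·|G^η_{(j)}(0)(x+e_μ,x′) − G^η_{(j)}(0)(x,x′)| ≤ C″·(L^jη)` (`n = L^k`; `(L^jη) = (sc ℓ k j)^{−1}`) — the pointwise law
`B3Ineq210ZeroLattice.abs_pieceLatDiff_le` summed with the uniform lattice sum at decay length `L^j`.
[cite: Balaban1983Higgs3, (2.10) p.426 (derivative clause); dictionary (zero field, Ω = ηℤ^{d+1}, row-summed form)] -/
theorem pieceLatDiff_rowSum_le (d ℓ : ℕ) (hℓ : 1 ≤ ℓ) (amin aplus m2plus : ℝ) (ha : 0 < amin) :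
    ∃ C'' : ℝ, 0 < C'' ∧ ∀ (k : ℕ), 1 ≤ k → ∀ (j : ℕ), j < k → ∀ (a m2 : ℝ), amin ≤ a → a ≤ aplus → 0 ≤ m2 →
      m2 ≤ m2plus → ∀ (μ : Fin (d + 1)) (x : Fin (d + 1) → ℤ) (F : Finset (Fin (d + 1) → ℤ)),
        ∑ x' ∈ F, (((ℓ + 1) ^ k : ℕ) : ℝ) * |pieceLat ℓ k j a m2 (x + Pi.single μ 1) x' - pieceLat ℓ k j a m2 x x'|
          ≤ C'' * (sc ℓ k j)⁻¹ := by
  obtain ⟨δ₁, C, hδ₁, hC, h⟩ := abs_pieceLatDiff_le d ℓ hℓ amin aplus m2plus ha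
  set K : ℝ := (2 * (1 + ((d : ℝ) + 1) / δ₁)) ^ (d + 1) with hK
  have hK0 : 0 < K := by positivity
  refine ⟨C * K, mul_pos hC hK0, ?_⟩
  intro k hk j hjk a m2 h1 h2 h3 h4 μ x F
  have hb1 : (1 : ℝ) ≤ ((bj ℓ j : ℕ) : ℝ) := by exact_mod_cast bj_pos ℓ j
  have hb0 : (0 : ℝ) < ((bj ℓ j : ℕ) : ℝ) := by linarith
  have hs := sc_pos ℓ k j
  have hpt : ∀ x', (((ℓ + 1) ^ k : ℕ) : ℝ) * |pieceLat ℓ k j a m2 (x + Pi.single μ 1) x' - pieceLat ℓ k j a m2 x x'|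
      ≤ C * (((((bj ℓ j : ℕ) : ℝ)) ^ (d + 1))⁻¹ * (sc ℓ k j)⁻¹)
        * Real.exp (-(δ₁ * supNorm (x - x') / ((bj ℓ j : ℕ) : ℝ))) :=
    fun x' => h k hk j hjk a m2 h1 h2 h3 h4 μ x x'
  have hsum := sum_exp_neg_div_le (d := d) hδ₁ hb1 x F
  calc ∑ x' ∈ F, (((ℓ + 1) ^ k : ℕ) : ℝ) * |pieceLat ℓ k j a m2 (x + Pi.single μ 1) x' - pieceLat ℓ k j a m2 x x'|
      ≤ ∑ x' ∈ F, C * (((((bj ℓ j : ℕ) : ℝ)) ^ (d + 1))⁻¹ * (sc ℓ k j)⁻¹)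
          * Real.exp (-(δ₁ * supNorm (x - x') / ((bj ℓ j : ℕ) : ℝ))) := Finset.sum_le_sum fun x' _ => hpt x'
    _ = C * (((((bj ℓ j : ℕ) : ℝ)) ^ (d + 1))⁻¹ * (sc ℓ k j)⁻¹)
          * ∑ x' ∈ F, Real.exp (-(δ₁ * supNorm (x - x') / ((bj ℓ j : ℕ) : ℝ))) := by rw [Finset.mul_sum]
    _ ≤ C * (((((bj ℓ j : ℕ) : ℝ)) ^ (d + 1))⁻¹ * (sc ℓ k j)⁻¹)
          * (2 * ((bj ℓ j : ℕ) : ℝ) * (1 + ((d : ℝ) + 1) / δ₁)) ^ (d + 1) :=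
        mul_le_mul_of_nonneg_left hsum (by positivity)
    _ = C * K * (sc ℓ k j)⁻¹ := by
        rw [hK, show (2 * ((bj ℓ j : ℕ) : ℝ) * (1 + ((d : ℝ) + 1) / δ₁))
          = ((bj ℓ j : ℕ) : ℝ) * (2 * (1 + ((d : ℝ) + 1) / δ₁)) by ring, mul_pow]
        field_simp

section Consequences

variable {ℓ k j : ℕ} {a m2 C' : ℝ}

/-- the full row (and, by `pieceLat_comm`, column) series of `|G^η_{(j)}(0)|` converges with sum `≤ C′(L^jη)²`, given the finite
partial-sum bound of `pieceLat_rowSum_le`. [cite: Balaban1983Higgs3, (2.10) p.426; dictionary (zero field, Ω = ηℤ^{d+1}, row-summed form)] -/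
theorem pieceLat_row_summable {x : Fin (d + 1) → ℤ}
    (hF : ∀ F : Finset (Fin (d + 1) → ℤ), ∑ x' ∈ F, |pieceLat ℓ k j a m2 x x'| ≤ C' * (sc ℓ k j ^ 2)⁻¹) :
    (Summable fun x' => |pieceLat ℓ k j a m2 x x'|) ∧ (Summable fun x' => |pieceLat ℓ k j a m2 x' x|) ∧
      ∑' x', |pieceLat ℓ k j a m2 x x'| ≤ C' * (sc ℓ k j ^ 2)⁻¹ := by
  have hs : Summable fun x' => |pieceLat ℓ k j a m2 x x'| := summable_of_sum_le (fun _ => abs_nonneg _) hF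
  exact ⟨hs, hs.congr fun x' => by rw [pieceLat_comm], Real.tsum_le_of_sum_le (fun _ => abs_nonneg _) hF⟩

/-- **`‖G^η_{(j)}(0)‖_{ℓ^∞ → ℓ^∞} ≤ O(1)(L^jη)²`**: for every bounded `f : ηℤ^{d+1} → ℂ` (`‖f(x′)‖ ≤ F_∞`) the series
`(G^η_{(j)}(0)f)(x) = Σ_{x′}G^η_{(j)}(0)(x,x′)f(x′)` converges absolutely and `|(G^η_{(j)}(0)f)(x)| ≤ C′(L^jη)²F_∞`, uniformly in
`k`, `j < k` and the window (given the row bound of `pieceLat_rowSum_le`). [cite: Balaban1983Higgs3, (2.10) p.426 («These inequalities will be used in the next chapter»), p.437 («we can estimate (3.16) by a constant»); dictionary (row-summed form)] -/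
theorem pieceLat_apply_le {x : Fin (d + 1) → ℤ}
    (hF : ∀ F : Finset (Fin (d + 1) → ℤ), ∑ x' ∈ F, |pieceLat ℓ k j a m2 x x'| ≤ C' * (sc ℓ k j ^ 2)⁻¹)
    {f : (Fin (d + 1) → ℤ) → ℂ} {Fsup : ℝ} (hf : ∀ x', ‖f x'‖ ≤ Fsup) :
    (Summable fun x' => ((pieceLat ℓ k j a m2 x x' : ℝ) : ℂ) * f x') ∧
      ‖∑' x', ((pieceLat ℓ k j a m2 x x' : ℝ) : ℂ) * f x'‖ ≤ C' * (sc ℓ k j ^ 2)⁻¹ * Fsup := by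
  have hFsup : 0 ≤ Fsup := (norm_nonneg _).trans (hf x)
  obtain ⟨hs, -, ht⟩ := pieceLat_row_summable hF
  have hmaj : ∀ x', ‖((pieceLat ℓ k j a m2 x x' : ℝ) : ℂ) * f x'‖ ≤ |pieceLat ℓ k j a m2 x x'| * Fsup := by
    intro x'
    rw [norm_mul, Complex.norm_real, Real.norm_eq_abs]
    exact mul_le_mul_of_nonneg_left (hf x') (abs_nonneg _)
  refine ⟨Summable.of_norm_bounded (hs.mul_right _) hmaj, (tsum_of_norm_bounded (hs.mul_right _).hasSum hmaj).trans ?_⟩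
  rw [tsum_mul_right]
  exact mul_le_mul_of_nonneg_right ht hFsup

end Consequences

/-! ## §2 Non-vacuity: the hypotheses are met (`d + 1 = 4`, `L = 2`, window `a ∈ [1/2, 2]`, `m² ∈ [0, 1]`) -/

/-- the row bound at the physical dimension `d + 1 = 4`, `L = 2`. -/
example : ∃ C' : ℝ, 0 < C' ∧ ∀ (k : ℕ), 1 ≤ k → ∀ (j : ℕ), j < k → ∀ (a m2 : ℝ), (1 / 2 : ℝ) ≤ a → a ≤ 2 → 0 ≤ m2 →
      m2 ≤ 1 → ∀ (x : Fin (3 + 1) → ℤ) (F : Finset (Fin (3 + 1) → ℤ)),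
        ∑ x' ∈ F, |pieceLat 1 k j a m2 x x'| ≤ C' * (sc 1 k j ^ 2)⁻¹ :=
  pieceLat_rowSum_le 3 1 le_rfl (1 / 2) 2 1 (by norm_num)

/-- the quantifier prefix is inhabited (`k = 1`, `j = 0`, `a = 1`, `m² = 0`). -/
example : (1 : ℕ) ≤ 1 ∧ (0 : ℕ) < 1 ∧ (1 / 2 : ℝ) ≤ 1 ∧ (1 : ℝ) ≤ 2 ∧ (0 : ℝ) ≤ 0 ∧ (0 : ℝ) ≤ 1 :=
  ⟨le_rfl, Nat.one_pos, by norm_num, by norm_num, le_rfl, by norm_num⟩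

end

end Literature.MathematicalPhysics.QuantumFieldTheory.Balaban1983to89.B3Ineq210ZeroLatticeRow
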